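import Summits.BirchSwinnertonDyer.BirchSwinnertonDyer.Theorems.GenusKolyvaginAtTwoGenusPrimitiveSupplyAtTwoTwoAdicImageOverK
import HarnessLib

/-!
# Route `GenusKolyvaginAtTwo`, crux `GenusPrimitiveSupplyAtTwo` (stmt-BirchSwinnertonDyer-22136):
# the `2`-adic image over the Heegner field — SHARPNESS: the crux's side conditions are NECESSARY,
# and the transfer `ℚ → K` is an EQUIVALENCE

Seat `bsd-line-gk2-p5` g13 (WIDTH-5 attach, SUPPLY lineage; helper `--supports
stmt-BirchSwinnertonDyer-22136`). THEOREMS ONLY: no definition, no named fact, no `sorry`; no item is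
closed; BSD is not proved by any of this.

`…TwoAdicImageOverK.lean` (p663733) proves: `ρ̄_{W,2ⁿ}` onto over `ℚ` for all `n ≥ 1`, `[K : ℚ] = 2`,
`d_K` odd, `d_K·(±Δ), d_K·(±2Δ) ∉ ℚ²` ⟹ `ρ̄_{W⁄K,2ⁿ}` onto over `K` for all `n ≥ 1`. This file proves
the CONVERSES, so that the crux's side conditions are exactly right (a BC5-type witness for the
planner / refuters: drop any one of them and the over-`K` image fails at level `2`, `4` or `8`):

* §1 `hasSurjectiveModNGaloisRep_of_baseChange` — onto over `K` ⟹ onto over `ℚ` (any number field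
  `K`; `E(ℚ̄)[n] ≃ E(K̄)[n]` equivariantly along `res : Γ_K → Γ_ℚ`, `RatClosure.torsionEquiv_smul`).
* §2 over ANY field of characteristic `≠ 2`: `ρ̄₄` onto ⟹ `√−1 ∉ K` (`diag(1,3)` moves `ζ₄`);
  `ρ̄₈` onto ⟹ `√2, √−2 ∉ K` (`diag(1,3)`, `diag(1,5)` move `ζ₈ + ζ₈⁷`, `ζ₈ + ζ₈³`) — the field-level
  content of "`ℚ(E[4]) ⊃ ℚ(√−1)`, `ℚ(E[8]) ⊃ ℚ(√±2)`" (Weil pairing).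
* §3 `[K : ℚ] = 2`: `d_K·r ∈ ℚ²` ⟹ `r ∈ K²` (`isSquare_algebraMap_of_isSquare_discr_mul`); hence
  `d_K·Δ ∈ ℚ²` kills level `2` over `K`, `d_K·(−Δ) ∈ ℚ²` kills level `4`, `d_K·(±2Δ) ∈ ℚ²` kill level `8`,
  and `d_K ∈ {−4, 8, −8}` (`K = ℚ(√−1), ℚ(√±2)`) kill level `4` resp. `8`.
* §4 **`forall_hasSurjectiveModNGaloisRep_baseChange_two_pow_iff`** — for `[K : ℚ] = 2`, `d_K` odd:
  (`ρ̄_{W⁄K,2ⁿ}` onto ∀ `n ≥ 1`) ⟺ (`ρ̄_{W,2ⁿ}` onto ∀ `n ≥ 1`) ∧ `d_K·Δ, d_K·(−Δ), d_K·2Δ, d_K·(−2Δ) ∉ ℚ²`;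
  **`…_iff_of_isImaginaryQuadratic`** — on the habitat (`ρ̄_{W,2ⁿ}` onto over `ℚ`), `K` imaginary
  quadratic with `d_K` odd: (onto over `K` ∀ `n ≥ 1`) ⟺ `d_K·(−|Δ|) ∉ ℚ² ∧ d_K·(−2|Δ|) ∉ ℚ²` — the crux's
  two side conditions VERBATIM are equivalent to `K ∩ ℚ(E[2^∞]) = ℚ`.

References: [DokchitserDokchitserMathZ2012] Theorem (1)–(3) and proof ("`ℚ(E[4]) ⊃ ℚ(√Δ, √−1)`",
"`ℚ(E[8]) ⊃ ℚ(√Δ, √−1, √2)`"); [SilvermanAEC2009] III.8 (Weil pairing); [GrossLMS1991] §9.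
-/

-- single-conjunct summit: `Summit.BirchSwinnertonDyer.BirchSwinnertonDyer.…` repeats the name by design
set_option linter.dupNamespace false
set_option autoImplicit false

noncomputable section

open scoped Classical

namespace Summit.BirchSwinnertonDyer.BirchSwinnertonDyer.Theorems.GenusKolyTwoAdicK

open WeierstrassCurve Field Matrix
open Literature.NumberTheory.EllipticCurves Literature.NumberTheory.GaloisRepresentations
open Literature.NumberTheory.EllipticCurves.DokchitserDokchitser2012

universe u

/-! ### §1 Descent `K → ℚ`: onto over `K` ⟹ onto over `ℚ` -/

section Descent

variable {K : Type u} [Field K] [NumberField K] (W : WeierstrassCurve ℚ)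

/-- **`ρ̄_{W⁄K,n}` onto ⟹ `ρ̄_{W,n}` onto** for any number field `K`: an automorphism `A₀` of
`E(ℚ̄)[n]` transported to `E(K̄)[n]` along `RatClosure.torsionEquiv` is some `g ∈ Γ_K`, and then
`res g ∈ Γ_ℚ` acts as `A₀` (`torsionEquiv_smul`). [cite: SilvermanAEC2009, III.7 (ρ̄_m)] -/
theorem hasSurjectiveModNGaloisRep_of_baseChange {n : ℤ}
    (h : (W.baseChange K).HasSurjectiveModNGaloisRep n) : W.HasSurjectiveModNGaloisRep n := by
  intro A₀
  set θ := RatClosure.torsionEquiv (K := K) W n with hθ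
  set A : geomTorsion (W.baseChange K) n ≃+ geomTorsion (W.baseChange K) n :=
    θ.symm.trans ((Multiplicative.toAdd A₀).trans θ) with hA
  obtain ⟨g, hg⟩ := h (Multiplicative.ofAdd A)
  refine ⟨absGaloisRestrict ℚ K g, Multiplicative.toAdd.injective (AddEquiv.ext fun P ↦ ?_)⟩
  rw [galoisRepTorsion_apply]
  apply θ.injective
  have hgP := congrArg (fun f : Multiplicative (AddAut (geomTorsion (W.baseChange K) n)) ↦
    f.toAdd (θ P)) hg
  simp only [galoisRepTorsion_apply, toAdd_ofAdd] at hgP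
  rw [RatClosure.torsionEquiv_smul, hgP, hA]
  simp [hθ]

end Descent

/-! ### §2 Over any field with `2 ≠ 0`: `ρ̄₄` onto ⟹ `√−1 ∉ K`; `ρ̄₈` onto ⟹ `√±2 ∉ K` -/

section AnyField

variable {F : Type u} [Field F] (V : WeierstrassCurve F) [V.IsElliptic]

/-- `2 ≠ 0` in `F̄`. [folklore] -/
private theorem two_ne_zero_closure (h2 : (2 : F) ≠ 0) : (2 : AlgebraicClosure F) ≠ 0 := fun h ↦ h2 (by
  have : algebraMap F (AlgebraicClosure F) 2 = 0 := by rw [map_ofNat, h]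
  exact (map_eq_zero _).mp this)

omit [V.IsElliptic] in
/-- A `Γ_F`-fixed-up-to-sign square root: if `x ≠ 0` in `F̄` is moved to `−x` by some `σ` then `x²` is
not the image of a square of `F` (`x = ±(algebraMap q)` would be fixed; `2 ≠ 0`). [folklore] -/
private theorem not_isSquare_of_smul_eq_neg (h2 : (2 : F) ≠ 0) {x : AlgebraicClosure F} (hx : x ≠ 0)
    (σ : absoluteGaloisGroup F) (hσ : σ • x = -x) {c : F}
    (hc : algebraMap F (AlgebraicClosure F) c = x ^ 2) : ¬ IsSquare c := by
  rintro ⟨q, hq⟩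
  have hsq : (algebraMap F (AlgebraicClosure F) q) ^ 2 = x ^ 2 := by
    rw [sq, ← map_mul, ← hq, hc]
  have hfixq : σ • algebraMap F (AlgebraicClosure F) q = algebraMap F (AlgebraicClosure F) q :=
    (show AlgebraicClosure F ≃ₐ[F] AlgebraicClosure F from σ).commutes q
  have hfix : σ • x = x := by
    rcases eq_or_eq_neg_of_sq_eq_sq _ _ hsq with h | h
    · rw [← h, hfixq]
    · have h' : x = -algebraMap F (AlgebraicClosure F) q := by rw [h, neg_neg]
      rw [h', smul_neg, hfixq]
  rw [hfix] at hσ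
  have h2x : (2 : AlgebraicClosure F) * x = 0 := by linear_combination hσ
  exact mul_ne_zero (two_ne_zero_closure h2) hx h2x

/-- **`ρ̄_{E,4}` onto ⟹ `√−1 ∉ F`** (`char F ≠ 2`): `diag(1,3) ∈ Im ρ̄₄` sends `ζ₄ ↦ ζ₄³ = −ζ₄`
(`LevelFour.smul_zeta_eq`), while `−1 = q²` in `F` would make `ζ₄ = ±q` fixed — "`ℚ(E[4]) ⊃ ℚ(√−1)`".
[cite: DokchitserDokchitserMathZ2012, proof of the Theorem (ℚ(E[4]) ⊃ ℚ(√Δ, √−1))] -/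
theorem not_isSquare_neg_one_of_hasSurjectiveModNGaloisRep_four (h2 : (2 : F) ≠ 0)
    (h4 : V.HasSurjectiveModNGaloisRep 4) :
    ¬ IsSquare (-1 : F) := by
  obtain ⟨σ, hσ⟩ := (hasSurjectiveModNGaloisRep_iff_matrix V (LevelFour.frame4 V h2)).mp h4
    !![1, 0; 0, 3] ⟨3, by decide⟩
  refine not_isSquare_of_smul_eq_neg h2 (LevelFour.zeta_ne_zero V h2) σ ?_ ?_
  · rw [LevelFour.smul_zeta_eq, show LevelFour.M V h2 σ = !![1, 0; 0, 3] from hσ,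
      show GL2Mod4.cm1 (!![1, 0; 0, 3] : GL2Mod4.M4).det = 1 by decide, GL2Mod8.sgnUnit_one]
    push_cast; ring
  · rw [map_neg, map_one, LevelFour.zeta_sq]

/-- **`ρ̄_{E,8}` onto ⟹ `√2 ∉ F`**: `diag(1,3) ∈ Im ρ̄₈` sends `√2 = ζ₈ + ζ₈⁷ ↦ −√2` (`smul_sqrtTwo`,
`χ₂(3) = −1`) — "`ℚ(E[8]) ⊃ ℚ(√2)`". [cite: DokchitserDokchitserMathZ2012, proof of the Theorem (ℚ(E[8]) ⊃ ℚ(√Δ, √−1, √2))] -/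
theorem not_isSquare_two_of_hasSurjectiveModNGaloisRep_eight (h2 : (2 : F) ≠ 0)
    (h8 : V.HasSurjectiveModNGaloisRep 8) :
    ¬ IsSquare (2 : F) := by
  obtain ⟨σ, hσ⟩ := (hasSurjectiveModNGaloisRep_iff_matrix V (frame8 V h2)).mp h8
    !![1, 0; 0, 3] ⟨3, by decide⟩
  have hs0 : sqrtTwo V h2 ≠ 0 := fun h ↦ two_ne_zero_closure h2 (by
    have e := sqrtTwo_sq V h2
    rw [h, mul_zero] at e
    exact e.symm)
  refine not_isSquare_of_smul_eq_neg h2 hs0 σ ?_ ?_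
  · rw [smul_sqrtTwo, show M V h2 σ = !![1, 0; 0, 3] from hσ,
      show GL2Mod8.c2 (!![1, 0; 0, 3] : GL2Mod8.M8).det = 1 by decide, GL2Mod8.sgnUnit_one]
    push_cast; ring
  · rw [map_ofNat, sq, sqrtTwo_sq]

/-- **`ρ̄_{E,8}` onto ⟹ `√−2 ∉ F`**: `diag(1,5) ∈ Im ρ̄₈` sends `√−2 = ζ₈ + ζ₈³ ↦ −√−2` (`smul_sqrtNegTwo`,
`χ₋₂(5) = −1`) — "`ℚ(E[8]) ⊃ ℚ(√−2)`". [cite: DokchitserDokchitserMathZ2012, proof of the Theorem (ℚ(E[8]) ⊃ ℚ(√Δ, √−1, √2))] -/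
theorem not_isSquare_neg_two_of_hasSurjectiveModNGaloisRep_eight (h2 : (2 : F) ≠ 0)
    (h8 : V.HasSurjectiveModNGaloisRep 8) : ¬ IsSquare (-2 : F) := by
  obtain ⟨σ, hσ⟩ := (hasSurjectiveModNGaloisRep_iff_matrix V (frame8 V h2)).mp h8
    !![1, 0; 0, 5] ⟨5, by decide⟩
  have hs0 : sqrtNegTwo V h2 ≠ 0 := fun h ↦ two_ne_zero_closure h2 (by
    have h' := sqrtNegTwo_sq V h2
    rw [h, mul_zero] at h'
    linear_combination h')
  refine not_isSquare_of_smul_eq_neg h2 hs0 σ ?_ ?_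
  · rw [smul_sqrtNegTwo, show M V h2 σ = !![1, 0; 0, 5] from hσ,
      show GL2Mod8.c2 (!![1, 0; 0, 5] : GL2Mod8.M8).det + GL2Mod8.cm1 (!![1, 0; 0, 5] : GL2Mod8.M8).det
        = 1 by decide, GL2Mod8.sgnUnit_one]
    push_cast; ring
  · rw [map_neg, map_ofNat, sq, sqrtNegTwo_sq]

end AnyField

/-! ### §3 Over a quadratic field: each side condition is necessary -/

section Necessity

variable {K : Type} [Field K] [NumberField K] (W : WeierstrassCurve ℚ) [W.IsElliptic]

omit [W.IsElliptic] in
/-- **`d_K·r ∈ ℚ²` ⟹ `r ∈ K²`** (`[K : ℚ] = 2`): `d_K = δ²` in `K` (`Quadratic.exists_not_mem_range_sq_eq_discr`),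
so `r = (s/δ)²` when `d_K r = s²`. [folklore] -/
theorem isSquare_algebraMap_of_isSquare_discr_mul (hK2 : Module.finrank ℚ K = 2) {r : ℚ}
    (h : IsSquare ((NumberField.discr K : ℚ) * r)) : IsSquare (algebraMap ℚ K r) := by
  obtain ⟨δ, -, hδ⟩ :=
    Literature.NumberTheory.QuadraticFields.Quadratic.exists_not_mem_range_sq_eq_discr (K := K) hK2
  obtain ⟨s, hs⟩ := h
  have hd : (NumberField.discr K : ℚ) ≠ 0 := by exact_mod_cast NumberField.discr_ne_zero K
  have hδ0 : δ ≠ 0 := fun h0 ↦ by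
    rw [h0, sq, zero_mul, eq_comm, map_eq_zero_iff _ (algebraMap ℚ K).injective] at hδ
    exact hd hδ
  refine ⟨algebraMap ℚ K s / δ, ?_⟩
  have hr : r = s * s / (NumberField.discr K : ℚ) := by
    rw [← hs]; field_simp
  rw [hr, map_div₀, map_mul, div_mul_div_comm, ← sq δ, hδ]

/-- **`d_K·Δ ∈ ℚ²` (`K = ℚ(√Δ)`) kills level `2` over `K`**: then `Δ ∈ K²`, while `ρ̄_{W⁄K,2}` onto forces
`Δ ∉ K²` (Dokchitser–Dokchitser (1)). [cite: DokchitserDokchitserMathZ2012, Theorem (1)] -/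
theorem not_hasSurjectiveModNGaloisRep_baseChange_two_of_isSquare (hK2 : Module.finrank ℚ K = 2)
    (h : IsSquare ((NumberField.discr K : ℚ) * W.Δ)) :
    ¬ (W.baseChange K).HasSurjectiveModNGaloisRep 2 := by
  haveI : (W.baseChange K).IsElliptic := by rw [baseChange]; infer_instance
  haveI : PerfectField K := PerfectField.ofCharZero
  intro h2K
  refine not_isSquare_Δ_of_hasSurjectiveModNGaloisRep_two (W.baseChange K) two_ne_zero h2K ?_
  rw [baseChange_Δ]
  exact isSquare_algebraMap_of_isSquare_discr_mul hK2 h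

/-- **`d_K·(−Δ) ∈ ℚ²` (`K = ℚ(√−Δ)`) kills level `4` over `K`**: then `−Δ ∈ K²`, while `ρ̄_{W⁄K,4}` onto
forces `−Δ ∉ K²` (Dokchitser–Dokchitser (2)). [cite: DokchitserDokchitserMathZ2012, Theorem (2)] -/
theorem not_hasSurjectiveModNGaloisRep_baseChange_four_of_isSquare (hK2 : Module.finrank ℚ K = 2)
    (h : IsSquare ((NumberField.discr K : ℚ) * -W.Δ)) :
    ¬ (W.baseChange K).HasSurjectiveModNGaloisRep 4 := by
  haveI : (W.baseChange K).IsElliptic := by rw [baseChange]; infer_instance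
  intro h4K
  refine LevelFour.not_isSquare_neg_Δ_of_hasSurjectiveModNGaloisRep_four (W.baseChange K)
    two_ne_zero h4K ?_
  rw [baseChange_Δ, ← map_neg]
  exact isSquare_algebraMap_of_isSquare_discr_mul hK2 h

/-- **`d_K·(2Δ) ∈ ℚ²` or `d_K·(−2Δ) ∈ ℚ²` (`K = ℚ(√±2Δ)`) kills level `8` over `K`** (`d_K` odd): then
`±2Δ ∈ K²`, while `ρ̄_{W⁄K,8}` onto forces `2Δ, −2Δ ∉ K²` (Dokchitser–Dokchitser (3) over `K`, with
`√±2 ∉ K` from `d_K` odd). [cite: DokchitserDokchitserMathZ2012, Theorem (3)] -/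
theorem not_hasSurjectiveModNGaloisRep_baseChange_eight_of_isSquare (hK2 : Module.finrank ℚ K = 2)
    (hodd : Odd (NumberField.discr K))
    (h : IsSquare ((NumberField.discr K : ℚ) * (2 * W.Δ)) ∨
      IsSquare ((NumberField.discr K : ℚ) * (-2 * W.Δ))) :
    ¬ (W.baseChange K).HasSurjectiveModNGaloisRep 8 := by
  haveI : (W.baseChange K).IsElliptic := by rw [baseChange]; infer_instance
  haveI : PerfectField K := PerfectField.ofCharZero
  intro h8K
  obtain ⟨-, h2Δ, hn2Δ⟩ := (hasSurjectiveModNGaloisRep_eight_iff_of_two_ne_zero (W.baseChange K)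
    two_ne_zero (not_isSquare_two_of_odd_discr hK2 hodd)
    (not_isSquare_neg_two_of_odd_discr hK2 hodd)).mp h8K
  rw [baseChange_Δ] at h2Δ hn2Δ
  rcases h with h | h
  · refine h2Δ ?_
    rw [show (2 : K) * algebraMap ℚ K W.Δ = algebraMap ℚ K (2 * W.Δ) by rw [map_mul, map_ofNat]]
    exact isSquare_algebraMap_of_isSquare_discr_mul hK2 h
  · refine hn2Δ ?_
    rw [show (-2 : K) * algebraMap ℚ K W.Δ = algebraMap ℚ K (-2 * W.Δ) by
      rw [map_mul, map_neg, map_ofNat]]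
    exact isSquare_algebraMap_of_isSquare_discr_mul hK2 h

omit [W.IsElliptic] in
/-- `d_K = 4m` ⟹ `√m ∈ K` (`(δ/2)² = m` for `δ² = d_K`). [folklore] -/
theorem isSquare_intCast_of_discr_eq_four_mul (hK2 : Module.finrank ℚ K = 2) {m : ℤ}
    (hd : NumberField.discr K = 4 * m) : IsSquare ((m : ℤ) : K) := by
  obtain ⟨δ, -, hδ⟩ :=
    Literature.NumberTheory.QuadraticFields.Quadratic.exists_not_mem_range_sq_eq_discr (K := K) hK2
  rw [hd, map_intCast, Int.cast_mul, Int.cast_ofNat] at hδ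
  refine ⟨δ / 2, ?_⟩
  have e : δ / 2 * (δ / 2) = δ ^ 2 / 4 := by ring
  rw [e, hδ, mul_div_cancel_left₀ _ (by norm_num : (4 : K) ≠ 0)]

/-- **`K = ℚ(√−1)` (`d_K = −4`) kills level `4` over `K`** — necessity of "`d_K` odd" at level `4`.
[cite: DokchitserDokchitserMathZ2012, proof of the Theorem (ℚ(E[4]) ⊃ ℚ(√−1))] -/
theorem not_hasSurjectiveModNGaloisRep_baseChange_four_of_discr_eq_neg_four
    (hK2 : Module.finrank ℚ K = 2) (hd : NumberField.discr K = -4) :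
    ¬ (W.baseChange K).HasSurjectiveModNGaloisRep 4 := by
  haveI : (W.baseChange K).IsElliptic := by rw [baseChange]; infer_instance
  intro h4K
  refine not_isSquare_neg_one_of_hasSurjectiveModNGaloisRep_four (W.baseChange K) two_ne_zero h4K ?_
  have := isSquare_intCast_of_discr_eq_four_mul hK2 (m := -1) (by rw [hd]; norm_num)
  simpa using this

/-- **`K = ℚ(√2)` or `ℚ(√−2)` (`d_K = ±8`) kills level `8` over `K`** — necessity of "`d_K` odd" at level `8`.
[cite: DokchitserDokchitserMathZ2012, proof of the Theorem (ℚ(E[8]) ⊃ ℚ(√Δ, √−1, √2))] -/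
theorem not_hasSurjectiveModNGaloisRep_baseChange_eight_of_discr_eq (hK2 : Module.finrank ℚ K = 2)
    (hd : NumberField.discr K = 8 ∨ NumberField.discr K = -8) :
    ¬ (W.baseChange K).HasSurjectiveModNGaloisRep 8 := by
  haveI : (W.baseChange K).IsElliptic := by rw [baseChange]; infer_instance
  intro h8K
  rcases hd with hd | hd
  · refine not_isSquare_two_of_hasSurjectiveModNGaloisRep_eight (W.baseChange K) two_ne_zero h8K ?_
    have := isSquare_intCast_of_discr_eq_four_mul hK2 (m := 2) (by rw [hd]; norm_num)
    simpa using this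
  · refine not_isSquare_neg_two_of_hasSurjectiveModNGaloisRep_eight (W.baseChange K) two_ne_zero
      h8K ?_
    have := isSquare_intCast_of_discr_eq_four_mul hK2 (m := -2) (by rw [hd]; norm_num)
    simpa using this

end Necessity

/-! ### §4 The characterisation -/

section Iff

variable {K : Type} [Field K] [NumberField K] (W : WeierstrassCurve ℚ) [W.IsElliptic]

/-- **THE `2`-ADIC IMAGE OVER A QUADRATIC FIELD WITH ODD DISCRIMINANT — characterisation.** For `W/ℚ`
elliptic and `K` quadratic with `d_K` odd: `ρ̄_{W⁄K,2ⁿ}` is onto for every `n ≥ 1` iff `ρ̄_{W,2ⁿ}` is onto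
for every `n ≥ 1` AND `d_K·Δ, d_K·(−Δ), d_K·2Δ, d_K·(−2Δ) ∉ ℚ²` (⟸ `…TwoAdicImageOverK`; ⟹ §1 and §3 at
levels `2`, `4`, `8`). [cite: DokchitserDokchitserMathZ2012, Theorem (1)–(3) and its proof] -/
theorem forall_hasSurjectiveModNGaloisRep_baseChange_two_pow_iff (hK2 : Module.finrank ℚ K = 2)
    (hodd : Odd (NumberField.discr K)) :
    (∀ n : ℕ, 0 < n → (W.baseChange K).HasSurjectiveModNGaloisRep ((2 : ℤ) ^ n)) ↔
      (∀ n : ℕ, 0 < n → W.HasSurjectiveModNGaloisRep ((2 : ℤ) ^ n)) ∧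
        ¬ IsSquare ((NumberField.discr K : ℚ) * W.Δ) ∧ ¬ IsSquare ((NumberField.discr K : ℚ) * -W.Δ) ∧
        ¬ IsSquare ((NumberField.discr K : ℚ) * (2 * W.Δ)) ∧
        ¬ IsSquare ((NumberField.discr K : ℚ) * (-2 * W.Δ)) := by
  constructor
  · intro hK
    have h2K : (W.baseChange K).HasSurjectiveModNGaloisRep 2 := by simpa using hK 1 one_pos
    have h4K : (W.baseChange K).HasSurjectiveModNGaloisRep 4 := by simpa using hK 2 two_pos
    have h8K : (W.baseChange K).HasSurjectiveModNGaloisRep 8 := by simpa using hK 3 (by norm_num)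
    refine ⟨fun n hn ↦ hasSurjectiveModNGaloisRep_of_baseChange W (hK n hn),
      fun h ↦ not_hasSurjectiveModNGaloisRep_baseChange_two_of_isSquare W hK2 h h2K,
      fun h ↦ not_hasSurjectiveModNGaloisRep_baseChange_four_of_isSquare W hK2 h h4K,
      fun h ↦ not_hasSurjectiveModNGaloisRep_baseChange_eight_of_isSquare W hK2 hodd (Or.inl h) h8K,
      fun h ↦ not_hasSurjectiveModNGaloisRep_baseChange_eight_of_isSquare W hK2 hodd (Or.inr h) h8K⟩
  · rintro ⟨hρ, hdΔ, hdnΔ, hd2Δ, hdn2Δ⟩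
    exact hasSurjectiveModNGaloisRep_baseChange_two_pow_of_finrank_eq_two W hK2 hodd hdΔ hdnΔ hd2Δ
      hdn2Δ hρ

/-- **On the habitat, the crux's two side conditions ARE `K ∩ ℚ(E[2^∞]) = ℚ`.** For `W/ℚ` with `ρ̄_{W,2ⁿ}`
onto for all `n ≥ 1` and `K` imaginary quadratic with `d_K` odd:
`(∀ n ≥ 1, ρ̄_{W⁄K,2ⁿ} onto) ⟺ d_K·(−|Δ|) ∉ ℚ² ∧ d_K·(−2|Δ|) ∉ ℚ²` (the binders of
`GenusPrimitiveSupplyAtTwo` / `MultiGenusPrimitivityAtTwo`, verbatim). [cite: DokchitserDokchitserMathZ2012, Theorem (1)–(3) and its proof]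
[cite: GrossLMS1991, §9 (𝒢 = Gal(L/K) ≅ GL₂ when K ⊄ ℚ(E_p))] -/
theorem forall_hasSurjectiveModNGaloisRep_baseChange_two_pow_iff_of_isImaginaryQuadratic
    (hK : IsImaginaryQuadratic K) (hodd : Odd (NumberField.discr K))
    (hρ : ∀ n : ℕ, 0 < n → W.HasSurjectiveModNGaloisRep ((2 : ℤ) ^ n)) :
    (∀ n : ℕ, 0 < n → (W.baseChange K).HasSurjectiveModNGaloisRep ((2 : ℤ) ^ n)) ↔
      ¬ IsSquare ((NumberField.discr K : ℚ) * -|W.Δ|) ∧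
        ¬ IsSquare ((NumberField.discr K : ℚ) * (-(2 * |W.Δ|))) := by
  constructor
  · intro hKs
    obtain ⟨-, hdΔ, hdnΔ, hd2Δ, hdn2Δ⟩ :=
      (forall_hasSurjectiveModNGaloisRep_baseChange_two_pow_iff W hK.1 hodd).mp hKs
    rcases lt_or_gt_of_ne W.isUnit_Δ.ne_zero with hneg | hpos
    · rw [abs_of_neg hneg, neg_neg, show -(2 * -W.Δ) = 2 * W.Δ by ring]
      exact ⟨hdΔ, hd2Δ⟩
    · rw [abs_of_pos hpos, show -(2 * W.Δ) = -2 * W.Δ by ring]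
      exact ⟨hdnΔ, hdn2Δ⟩
  · rintro ⟨h₁, h₂⟩
    exact hasSurjectiveModNGaloisRep_baseChange_two_pow W hK hodd h₁ h₂ hρ

end Iff

end Summit.BirchSwinnertonDyer.BirchSwinnertonDyer.Theorems.GenusKolyTwoAdicK

end
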